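/-
Origin: expansion seat `planner-pub-hodgecm-pv08-g5-0`, handover #2 2026-08-18T07:05:12Z (`HOME/pub-hodgecm-pv08-g5/lean/Pv08g5/S5QautSeesawConservative.lean`, md5 43e84972, 348 lines);
landed by the gen-7 packager in gate run 25 as `HodgeCM/PerL34/S5QautSeesawConservative.lean` (import ^import Pv[0-9]+g[0-9]+\.→import HodgeCM.PerL34. ×2).
-/
/-
Origin: HOME/pub-hodgecm-pv08-g5/lean/Pv08g5/S5QautSeesawConservative.lean — session planner-pub-hodgecm-pv08-g5-0 (unit
pub-hodgecm-pv08-g5, DAG-NODE PROVER #08 gen 5).  LEMMAS.md v10 §9 **seam S5**, `N19g`/(34) half — STRENGTH of the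
lattice-shell record of `S5QautSeesaw.lean`.  Intended final place: `HodgeCM/PerL34/S5QautSeesawConservative.lean`,
after `HodgeCM/PerL34/S5QautSeesaw.lean` (this seat, HANDOVER #1) and `HodgeCM/PerL34/S5QautFockConservative.lean`
(pv08-g4 F2, run-25 queue); the two WIP imports below are to be rewritten `Pv08g5.` / `Pv08g4.` → `HodgeCM.PerL34.`.
New namespace `HodgeCM.PerL34.QautSeesaw.Conservative`.  Asserts nothing: no axiom, no placeholder proof, no print claim.
-/
import Summits.HodgeConjecture.HodgeCM.PerL34.S5QautSeesaw_2
import Summits.HodgeConjecture.HodgeCM.PerL34.S5QautFockConservative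

/-!
# Seam S5, `N19g` half: the lattice-shell record `QautSeesawBridge` is CONSERVATIVE over the leaf `N19g_core`

`S5QautSeesaw.lean` proved `Nonempty (QautSeesawBridge T V c D k l) → N19g_core T V c D k l` (through pv08-g4's
`QautFockBridge`).  Here the converse: from the leaf we build a (junk) lattice-shell record, so that

  `Nonempty (QautSeesawBridge T V c D k l) ↔ Nonempty (QautFockBridge T V c D k l) ↔ N19g_core T V c D k l`

(`nonempty_seesawBridge_iff`, `nonempty_seesawBridge_iff_fockBridge`) and, at binder level, the hypothesis of
`open_thetaReal34_of_seesawBridges` is EQUIVALENT to the model-level leaf binder of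
`OpenInputsN19.open_thetaReal34_of_core` (`seesawBridges_iff_core`).

READING (boundary census, not mathematics of [PerL]): moving (eq:seesaw)-on-pure-tensors and the `K`-type transport from
labelled fields (pv08-g4) to theorems over pv11's shell (pv08-g5) did NOT smuggle in strength — the S5 (34) binder is still
≡ the leaf; what changed is which sentences of Lemma 3.5's proof are computed rather than posited.

THE JUNK SHELL (§1–§2).  Archimedean side = pv08-g2's (`K = Circle × D₄`, `C = C(K, Idx →ᵇ ℂ)`, `σ` = right translation,
`κ` of pv08-g4 F2).  Lattice side: `G := K × Idx` (so that `evalC f (y,a) = f y a` is an INJECTIVE algebra homomorphism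
and `σ` is right translation in the first factor), `U(W_j)(𝔸) := Unit` with the Dirac measure, lattices `:= Unit`,
all three Schwartz spaces `:= C` with `φ₁ ⊗ φ₂ := φ₁ φ₂`, Weil action `ω((y,a),·)φ := (y' ↦ φ(y'y)(a)·1)` (a
representation: `omega_ract`), evaluation `ev φ := φ(1)(a₀)` at a chosen index.  Then `θ(φ)(y,a) = φ y a`, i.e. the
theta lift and the torus period of the shell are `evalC` itself, the theta maps are F2's `ψOf (form …)`, `periodC = id`,
and the field `ϑ_pr` is F2's `seesawPure` computation read backwards through pv02's linear `prL`.

Unit `pub-hodgecm-pv08-g5`, 2026-08-18.  Fully kernel-checked; standard axiom trio.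
-/

set_option autoImplicit false

noncomputable section

open MeasureTheory Matrix
open HodgeCM.Prior.Perl34File
open HodgeCM.PerL34.Qaut (pr prL prL_apply wedge)
open HodgeCM.PerL34.P43KTypesU2 (Jplus jplusSubmodule)
open HodgeCM.PerL34.QautFock (pPlusMat continuous_pPlusMat isUnit_det_pPlusMat formOf QautFockBridge ψOf
  ψOf_equivariant formOf_ψOf)
open HodgeCM.PerL34.QautFock.Conservative (κ κ_cont κ_k₀ d₀ d₀_pow_ne_one ρ_diag_κ ρ_antidiag_κ isForm_form_κ
  fockBridge_of_core nonempty_fockBridge_iff)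
open HodgeCM.PerL34.Seesaw
open HodgeCM.PerL34.S5ConservativeQaut (Idx B tr σ σ_apply σ_cont form WIdx toHG toHG_wedge)

namespace HodgeCM
namespace PerL34
namespace QautSeesaw
namespace Conservative

attribute [local instance] S5ConservativeQaut.topD4 S5ConservativeQaut.measD4 S5ConservativeQaut.measCircle

/-! ## §1. The junk lattice shell over pv08-g2's archimedean shell -/

section Shell

variable {X : Type} (s : Set X)

open Classical in
/-- scalar read-out of a coefficient `w ∈ (Idx →ᵇ ℂ)`: its value at a chosen index (`0` if there is none). -/
def L (w : B s) : ℂ := if h : Nonempty (Idx s) then w (Classical.choice h) else 0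

/-- (Ported verbatim from the HodgeCMPerL package; no docstring in the source.) -/
theorem L_smul_one (a : Idx s) (r : ℂ) : L s (r • (1 : B s)) = r := by
  have h : Nonempty (Idx s) := ⟨a⟩
  simp only [L, dif_pos h, BoundedContinuousFunction.coe_smul, BoundedContinuousFunction.coe_one, Pi.one_apply,
    smul_eq_mul, mul_one]

/-- (Ported verbatim from the HodgeCMPerL package; no docstring in the source.) -/
theorem L_mul (w w' : B s) : L s (w * w') = L s w * L s w' := by
  unfold L
  split_ifs with h
  · rfl
  · rw [mul_zero]

/-- (Ported verbatim from the HodgeCMPerL package; no docstring in the source.) -/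
theorem L_sub (w w' : B s) : L s (w - w') = L s w - L s w' := by
  unfold L
  split_ifs with h
  · rfl
  · rw [sub_zero]

/-- `w ↦ w(a) · 1`: read the coefficient at the index `a` and spread it as a constant. -/
def cst (a : Idx s) : C(B s, B s) :=
  ⟨fun w => w a • (1 : B s), (BoundedContinuousFunction.evalCLM ℂ a).continuous.smul continuous_const⟩

/-- (Ported verbatim from the HodgeCMPerL package; no docstring in the source.) -/
theorem cst_apply (a : Idx s) (w : B s) : cst s a w = w a • (1 : B s) := rfl

/-- the junk Weil action of `g = (y, a)`: `φ ↦ (y' ↦ φ(y'·y)(a) · 1)`. -/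
def trK (g : S5ConservativeQaut.K × Idx s) (φ : S5ConservativeQaut.C s) : S5ConservativeQaut.C s :=
  (cst s g.2).comp (φ.comp (tr g.1))

/-- (Ported verbatim from the HodgeCMPerL package; no docstring in the source.) -/
theorem trK_apply (g : S5ConservativeQaut.K × Idx s) (φ : S5ConservativeQaut.C s) (y : S5ConservativeQaut.K)
    (a : Idx s) : trK s g φ y a = φ (y * g.1) g.2 := by
  show (φ (y * g.1) g.2 • (1 : B s)) a = _
  simp only [BoundedContinuousFunction.coe_smul, BoundedContinuousFunction.coe_one, Pi.one_apply, smul_eq_mul,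
    mul_one]

/-- (Ported verbatim from the HodgeCMPerL package; no docstring in the source.) -/
theorem trK_one (g : S5ConservativeQaut.K × Idx s) (φ : S5ConservativeQaut.C s) :
    trK s g φ 1 = φ g.1 g.2 • (1 : B s) := by
  show φ (1 * g.1) g.2 • (1 : B s) = _
  rw [one_mul]

/-- (Ported verbatim from the HodgeCMPerL package; no docstring in the source.) -/
theorem trK_mul (g : S5ConservativeQaut.K × Idx s) (φ φ' : S5ConservativeQaut.C s) :
    trK s g (φ * φ') = trK s g φ * trK s g φ' := by
  apply ContinuousMap.ext; intro y; apply BoundedContinuousFunction.ext; intro a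
  rw [ContinuousMap.mul_apply, BoundedContinuousFunction.coe_mul, Pi.mul_apply, trK_apply, trK_apply, trK_apply,
    ContinuousMap.mul_apply, BoundedContinuousFunction.coe_mul, Pi.mul_apply]

/-- (Ported verbatim from the HodgeCMPerL package; no docstring in the source.) -/
theorem trK_sub (g : S5ConservativeQaut.K × Idx s) (φ φ' : S5ConservativeQaut.C s) :
    trK s g (φ - φ') = trK s g φ - trK s g φ' := by
  apply ContinuousMap.ext; intro y; apply BoundedContinuousFunction.ext; intro a
  rw [ContinuousMap.sub_apply, BoundedContinuousFunction.coe_sub, Pi.sub_apply, trK_apply, trK_apply, trK_apply,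
    ContinuousMap.sub_apply, BoundedContinuousFunction.coe_sub, Pi.sub_apply]

/-- `ω` is a representation: `ω((y·x, a)) = ω((y, a)) ∘ R(x)`. -/
theorem trK_ract (x : S5ConservativeQaut.K) (g : S5ConservativeQaut.K × Idx s) (φ : S5ConservativeQaut.C s) :
    trK s (g.1 * x, g.2) φ = trK s g (σ s x φ) := by
  apply ContinuousMap.ext; intro y; apply BoundedContinuousFunction.ext; intro a
  rw [trK_apply, trK_apply, σ_apply, mul_assoc]

/-- `C = C(K, Idx →ᵇ ℂ)` IS an algebra of functions on `G = K × Idx`. -/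
def evalC : S5ConservativeQaut.C s →ₐ[ℂ] (S5ConservativeQaut.K × Idx s → ℂ) where
  toFun f g := f g.1 g.2
  map_one' := by
    funext g
    rw [Pi.one_apply, ContinuousMap.one_apply, BoundedContinuousFunction.coe_one, Pi.one_apply]
  map_mul' _ _ := by
    funext g
    rw [Pi.mul_apply, ContinuousMap.mul_apply, BoundedContinuousFunction.coe_mul, Pi.mul_apply]
  map_zero' := by
    funext g
    rw [Pi.zero_apply, ContinuousMap.zero_apply, BoundedContinuousFunction.coe_zero, Pi.zero_apply]
  map_add' _ _ := by
    funext g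
    rw [Pi.add_apply, ContinuousMap.add_apply, BoundedContinuousFunction.coe_add, Pi.add_apply]
  commutes' r := by
    funext g
    rw [Pi.algebraMap_apply, Algebra.algebraMap_self_apply, Algebra.algebraMap_eq_smul_one]
    simp only [ContinuousMap.smul_apply, ContinuousMap.one_apply, BoundedContinuousFunction.coe_smul,
      BoundedContinuousFunction.coe_one, Pi.one_apply, smul_eq_mul, mul_one]

/-- (Ported verbatim from the HodgeCMPerL package; no docstring in the source.) -/
theorem evalC_apply (f : S5ConservativeQaut.C s) (g : S5ConservativeQaut.K × Idx s) : evalC s f g = f g.1 g.2 := rfl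

/-- (Ported verbatim from the HodgeCMPerL package; no docstring in the source.) -/
theorem evalC_injective : Function.Injective (evalC s) := fun _ _ h =>
  ContinuousMap.ext fun y => BoundedContinuousFunction.ext fun a => congr_fun h (y, a)

/-- **The junk lattice shell**: `G := K × Idx`, `U(W_j)(𝔸) := Unit`, lattices `:= Unit`, `𝒮_j = 𝒮 := C`,
`φ₁ ⊗ φ₂ := φ₁ φ₂`, `ω := trK`, `ev φ := L (φ 1)`. -/
abbrev DSj : ThetaSeesawData where
  G := S5ConservativeQaut.K × Idx s
  A₁ := Unit
  A₂ := Unit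
  X₁ := Unit
  X₂ := Unit
  S₁ := S5ConservativeQaut.C s
  S₂ := S5ConservativeQaut.C s
  S := S5ConservativeQaut.C s
  ev₁ φ _ := L s (φ 1)
  ev₂ φ _ := L s (φ 1)
  ev Φ _ := L s (Φ 1)
  tmul φ₁ φ₂ := φ₁ * φ₂
  ω₁ g _ φ := trK s g φ
  ω₂ g _ φ := trK s g φ
  ωW g _ Φ := trK s g Φ

/-- (Ported verbatim from the HodgeCMPerL package; no docstring in the source.) -/
theorem omegaSub : (DSj s).OmegaSub := fun g _ Φ Φ' => trK_sub s g Φ Φ'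

/-- (Ported verbatim from the HodgeCMPerL package; no docstring in the source.) -/
theorem evSub : (DSj s).EvSub := fun Φ Φ' _ => by
  show L s ((Φ - Φ') 1) = L s (Φ 1) - L s (Φ' 1)
  rw [ContinuousMap.sub_apply, L_sub]

/-- (Ported verbatim from the HodgeCMPerL package; no docstring in the source.) -/
theorem evalTmul : (DSj s).EvalTmul := fun φ₁ φ₂ _ => by
  show L s ((φ₁ * φ₂) 1) = L s (φ₁ 1) * L s (φ₂ 1)
  rw [ContinuousMap.mul_apply, L_mul]

/-- (Ported verbatim from the HodgeCMPerL package; no docstring in the source.) -/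
theorem restrictTmul : (DSj s).RestrictTmul := fun g _ _ φ₁ φ₂ => trK_mul s g φ₁ φ₂

/-- (Ported verbatim from the HodgeCMPerL package; no docstring in the source.) -/
theorem absSummable₁ : (DSj s).AbsSummable₁ := fun _ => (hasSum_fintype _).summable

/-- (Ported verbatim from the HodgeCMPerL package; no docstring in the source.) -/
theorem absSummable₂ : (DSj s).AbsSummable₂ := fun _ => (hasSum_fintype _).summable

/-- `θ_φ((y,a), u) = φ(y)(a)`. -/
theorem thetaKernel₁_eq (φ : S5ConservativeQaut.C s) (g : S5ConservativeQaut.K × Idx s) (u : Unit) :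
    (DSj s).thetaKernel₁ φ g u = φ g.1 g.2 := by
  show ∑' _ : Unit, L s (trK s g φ 1) = _
  rw [tsum_fintype, Fintype.sum_unique, trK_one, L_smul_one s g.2]

/-- (Ported verbatim from the HodgeCMPerL package; no docstring in the source.) -/
theorem thetaKernel₂_eq (φ : S5ConservativeQaut.C s) (g : S5ConservativeQaut.K × Idx s) (u : Unit) :
    (DSj s).thetaKernel₂ φ g u = φ g.1 g.2 := by
  show ∑' _ : Unit, L s (trK s g φ 1) = _
  rw [tsum_fintype, Fintype.sum_unique, trK_one, L_smul_one s g.2]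

/-- (Ported verbatim from the HodgeCMPerL package; no docstring in the source.) -/
theorem thetaKernel_eq (Φ : S5ConservativeQaut.C s) (g : S5ConservativeQaut.K × Idx s) (t : Unit × Unit) :
    (DSj s).thetaKernel Φ g t = Φ g.1 g.2 := by
  show ∑' _ : Unit × Unit, L s (trK s g Φ 1) = _
  rw [tsum_fintype, Finset.sum_const, Finset.card_univ, Fintype.card_prod, Fintype.card_unit, mul_one, one_smul,
    trK_one, L_smul_one s g.2]

/-- the theta lift of the junk shell (Dirac measure, trivial character) is `evalC`. -/
theorem thetaLift₁_eq (φ : S5ConservativeQaut.C s) (g : S5ConservativeQaut.K × Idx s) :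
    (DSj s).thetaLift₁ (Measure.dirac ()) (fun _ => 1) φ g = φ g.1 g.2 := by
  show ∫ u, (DSj s).thetaKernel₁ φ g u * 1 ∂(Measure.dirac ()) = _
  rw [integral_dirac, thetaKernel₁_eq, mul_one]

/-- (Ported verbatim from the HodgeCMPerL package; no docstring in the source.) -/
theorem thetaLift₂_eq (φ : S5ConservativeQaut.C s) (g : S5ConservativeQaut.K × Idx s) :
    (DSj s).thetaLift₂ (Measure.dirac ()) (fun _ => 1) φ g = φ g.1 g.2 := by
  show ∫ u, (DSj s).thetaKernel₂ φ g u * 1 ∂(Measure.dirac ()) = _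
  rw [integral_dirac, thetaKernel₂_eq, mul_one]

/-- … and so is the torus period. -/
theorem thetaPeriod_eq (Φ : S5ConservativeQaut.C s) (g : S5ConservativeQaut.K × Idx s) :
    (DSj s).thetaPeriod (Measure.dirac ()) (Measure.dirac ()) (fun _ => 1) (fun _ => 1) Φ g = Φ g.1 g.2 := by
  show ∫ t, (DSj s).thetaKernel Φ g t * ((1 : ℂ) * 1) ∂((Measure.dirac ()).prod (Measure.dirac ())) = _
  rw [Measure.dirac_prod_dirac, integral_dirac, thetaKernel_eq, mul_one, mul_one]

end Shell

/-! ## §2. The junk lattice-shell record over the leaf, and conservativity -/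

section Bridge

variable {U : Universe} (T : U.ThetaModel)
variable {L : CMField} {ι₁ : L →+* ℂ} (V : HermSpace3 L ι₁) (c : SeesawCtx L)
variable (D : Perl34.TorusData (T.core V c)) (k l : Fin 4)

/-- **The junk lattice-shell record**: every field of `QautSeesawBridge` discharged over the leaf `N19g_core`. -/
def seesawBridge_of_core (hcore : N19g_core T V c D k l) : QautSeesawBridge T V c D k l where
  K := S5ConservativeQaut.K
  μ := S5ConservativeQaut.μ
  C := S5ConservativeQaut.C (T.wedgeSet V c k l)
  σ := σ _
  σ_cont := σ_cont _
  κ := κ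
  κ_cont := κ_cont
  ρ_diag := ρ_diag_κ
  ρ_antidiag := ρ_antidiag_κ
  k₀ := S5ConservativeQaut.k₀
  d₀ := d₀
  κ_k₀ := κ_k₀
  d₀_pow_ne_one := d₀_pow_ne_one
  toHG := toHG T V c k l
  DS := DSj (T.wedgeSet V c k l)
  ν₁ := Measure.dirac ()
  ν₂ := Measure.dirac ()
  omegaSub := omegaSub _
  evSub := evSub _
  evalTmul := evalTmul _
  restrictTmul := restrictTmul _
  absSummable₁ := absSummable₁ _
  absSummable₂ := absSummable₂ _
  evalC := evalC _
  evalC_injective := evalC_injective _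
  ract x g := (g.1 * x, g.2)
  evalC_sigma _ _ _ := rfl
  ωK₁ x φ := σ _ x φ
  ωK₂ x φ := σ _ x φ
  omega_ract₁ x g _ φ := trK_ract _ x g φ
  omega_ract₂ x g _ φ := trK_ract _ x g φ
  ch₁ _ _ := 1
  ch₂ _ _ := 1
  Away₁ := WIdx T V c k l
  Away₂ := Unit
  Adm₁ _ _ := True
  Adm₂ _ _ := True
  emb₁ a p := ψOf (form _ (S5ConservativeQaut.ind _ a) 0) p
  emb₂ _ p := ψOf (form _ 1 1) p
  emb_equiv₁ _ a _ x p := ψOf_equivariant κ (σ _) _ (isForm_form_κ _ _ _) x p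
  emb_equiv₂ _ _ _ x p := ψOf_equivariant κ (σ _) _ (isForm_form_κ _ _ _) x p
  integrable₁ _ _ _ _ _ := Integrable.of_finite
  integrable₂ _ _ _ _ _ := Integrable.of_finite
  thetaJ₁ _ a := ψOf (form _ (S5ConservativeQaut.ind _ a) 0)
  thetaJ₂ _ _ := ψOf (form _ 1 1)
  evalC_thetaJ₁ _ a p := funext fun g => (thetaLift₁_eq _ (ψOf (form _ (S5ConservativeQaut.ind _ a) 0) p) g).symm
  evalC_thetaJ₂ _ _ p := funext fun g => (thetaLift₂_eq _ (ψOf (form _ 1 1) p) g).symm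
  periodC _ Φ := Φ
  evalC_periodC _ Φ := funext fun g => (thetaPeriod_eq _ Φ g).symm
  wedge_mem := by
    intro χ _ a _ _ _
    rw [formOf_ψOf, formOf_ψOf, toHG_wedge]
    exact a.mem
  P := hcore.choose
  dense := hcore.choose_spec.1
  ϑ_pr := by
    intro χ hχ Φ hΦ
    obtain ⟨n, ψ₁, ψ₂, p₁, p₂, hmem, hϑ⟩ := (fockBridge_of_core T V c D k l hcore).seesawPure χ hχ Φ hΦ
    have h₁ : ∀ i, ∃ a : WIdx T V c k l,
        (ψOf (form _ (S5ConservativeQaut.ind (T.wedgeSet V c k l) a) 0) :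
          jplusSubmodule →ₗ[ℂ] S5ConservativeQaut.C (T.wedgeSet V c k l)) = ψ₁ i :=
      fun i => (hmem i).1
    choose a₁ ha₁ using h₁
    have h₂ : ∀ i, ψ₂ i = (ψOf (form (T.wedgeSet V c k l) 1 1) :
        jplusSubmodule →ₗ[ℂ] S5ConservativeQaut.C (T.wedgeSet V c k l)) := fun i => (hmem i).2
    refine ⟨n, a₁, fun _ => (), p₁, p₂, fun _ => ⟨trivial, trivial⟩, ?_⟩
    rw [hϑ]
    have hρc : Continuous fun x => (pPlusMat.comp κ) x := continuous_pPlusMat.comp κ_cont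
    have hρd : ∀ x, IsUnit ((pPlusMat.comp κ) x).det := fun x => isUnit_det_pPlusMat (κ x)
    show toHG T V c k l (∑ i, pr S5ConservativeQaut.μ (pPlusMat.comp κ) (σ _) (ψ₁ i (p₁ i) * ψ₂ i (p₂ i))) =
      toHG T V c k l (pr S5ConservativeQaut.μ (pPlusMat.comp κ) (σ _)
        (∑ i, ψOf (form _ (S5ConservativeQaut.ind _ (a₁ i)) 0) (p₁ i) * ψOf (form _ 1 1) (p₂ i)))
    simp only [← prL_apply hρc hρd (σ_cont _), map_sum, ha₁, h₂]
    rfl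

/-- **`N19g_core → Nonempty QautSeesawBridge`**. -/
theorem nonempty_seesawBridge_of_core (hcore : N19g_core T V c D k l) :
    Nonempty (QautSeesawBridge T V c D k l) :=
  ⟨seesawBridge_of_core T V c D k l hcore⟩

/-- **CONSERVATIVITY of the lattice-shell S5 record**: in logical strength `QautSeesawBridge` is exactly the leaf
`N19g_core` (→ : `S5QautSeesaw.N19g_core_of_seesawBridge`; ← : the junk record above). -/
theorem nonempty_seesawBridge_iff : Nonempty (QautSeesawBridge T V c D k l) ↔ N19g_core T V c D k l :=
  ⟨fun ⟨R⟩ => N19g_core_of_seesawBridge R, nonempty_seesawBridge_of_core T V c D k l⟩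

/-- … hence exactly pv08-g4's record (`S5QautFockConservative.nonempty_fockBridge_iff`). -/
theorem nonempty_seesawBridge_iff_fockBridge :
    Nonempty (QautSeesawBridge T V c D k l) ↔ Nonempty (QautFockBridge T V c D k l) :=
  (nonempty_seesawBridge_iff T V c D k l).trans (nonempty_fockBridge_iff T V c D k l).symm

end Bridge

section Binder

variable {U : Universe} (T : U.ThetaModel)

/-- **Binder-level form**: the hypothesis of `S5QautSeesaw.open_thetaReal34_of_seesawBridges` ("a lattice-shell
record in every good context on the `(34)` side") is EQUIVALENT to the model-level leaf binder `hcore` of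
`OpenInputsN19.open_thetaReal34_of_core`. -/
theorem seesawBridges_iff_core :
    (∀ {L : CMField} {ι₁ : L →+* ℂ} (V : HermSpace3 L ι₁) (c : SeesawCtx L), T.GoodCtx ι₁ c →
      Nonempty (QautSeesawBridge T V c (T.t34 V c) 2 3)) ↔
    (∀ {L : CMField} {ι₁ : L →+* ℂ} (V : HermSpace3 L ι₁) (c : SeesawCtx L), T.GoodCtx ι₁ c →
      N19g_core T V c (T.t34 V c) 2 3) :=
  ⟨fun h _ _ V c hc => (nonempty_seesawBridge_iff T V c _ 2 3).mp (h V c hc),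
   fun h _ _ V c hc => (nonempty_seesawBridge_iff T V c _ 2 3).mpr (h V c hc)⟩

end Binder

end Conservative
end QautSeesaw
end PerL34
end HodgeCM

end
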